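import Mathlib
import Summits.ValiantsHypothesis.ValiantsHypothesis.Theorems.NewtonUnitEquationsTwoProductsFormalLogLinearisationReduction
import Summits.ValiantsHypothesis.ValiantsHypothesis.Theorems.NewtonUnitEquationsTwoProductsFormalLogLinearisationLiftedPencilCountBound
import HarnessLib

/-!
# Route NewtonUnitEquations — crux `TwoProducts` (stmt-ValiantsHypothesis-5906), line `formal-log-linearisation`:
# `TwoProducts ⇐ PlanarCellBound` — the engine reduced to ONE weight-order cell of the tail support (sweep transfer)

Registered line `Cruxes/TwoProducts/Lines/formal-log-linearisation.lean` (NOT the item's skeleton of record; helper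
mode `--supports stmt-ValiantsHypothesis-5906 --as helper`, no stub credit claimed).  After `liftedPencilCount`
(`…LiftedPencilCountBound.lean`, the memo's LIFTED necessary condition, proved by SWEEP × SLOT-RANK) the open engine
`stub_logSumEngine` (= `LogSumEngine`, hypothesis of `twoProducts_of_logSumEngine`) splits the same way: the SWEEP
half transfers verbatim to the planar log-support, and what remains is the engine restricted to a CELL FAMILY —
log-visible points whose valid weights induce one common weight order on the tail support — stated here INLINE as the
hypothesis `PlanarCellBound` of the two theorems (no definition is introduced; val-lit desk RULING #103, scratch
`SCRATCH-p3g12-EngineFibreStep.lean`):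

* `planarOrder_classes` — for a finite set `E ⊂ ℕ²` there is a key `(Fin 2 → ℝ) → (Fin 3 × Fin 3) × (ℕ × Bool)` with
  `≤ 9·2(|E|²+1)` values such that weights with equal keys order `E` identically (`pencilOrder_classes` on the pencil
  `(1,0) + t(0,1)`, `t = ξ₁/ξ₀`, plus the signs of `ξ₀, ξ₁`);
* `logSumEngine_of_planarCellBound` — **`PlanarCellBound (a, b) ⇒ LogSumEngine (a + 7, b + 3)`**: split a finite set
  of log-visible points by the key of a witness weight; each class is a cell family;
* `twoProducts_of_planarCellBound` — composed with `twoProducts_of_logSumEngine` (p585696): **the crux follows from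
  `PlanarCellBound`**.

Where the `m`-uniformity must now enter (NOTE §12 of the theory note): inside `PlanarCellBound`, at the rank step —
the planar replacement matrices `(logDiff u v (η_y + e·e_x))_{x,y}` are triangular along the cell order, but their
entries are FIBRE SUMS of the unequal-moment function with multinomial weights, for which the Hankel rank `≤ 2m` of
the lifted proof is not available.  Honest framing: a CONDITIONAL reduction on a non-record line; `PlanarCellBound`,
`stub_logSumEngine` and the crux `TwoProducts` are OPEN and NOT claimed; nothing here is progress on `VP ≠ VNP`
(NOT proved).  No definitions, no named facts. [folklore]
-/

noncomputable section

-- Sub = Summit single-conjunct layout: the duplicated namespace component is mandated by the tree.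
set_option linter.dupNamespace false

open scoped BigOperators
open MvPolynomial

namespace Summit.ValiantsHypothesis.ValiantsHypothesis.Theorems.NewtonUnitEquations.TwoProducts.FormalLogLinearisation

/-- **Planar order classes.**  For a finite `E ⊂ ℕ²` there is a key on weights `ξ : Fin 2 → ℝ` with at most
`9 · 2(|E|² + 1)` values (signs of `ξ₀, ξ₁` and the cell code of `ξ₁/ξ₀` along the pencil `(1,0) + t·(0,1)`) such
that weights with the same key induce the same order `e ↦ wt ξ e` on `E`. [folklore] -/
theorem planarOrder_classes (E : Finset Expo) :
    ∃ key : (Fin 2 → ℝ) → (Fin 3 × Fin 3) × (ℕ × Bool),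
      (∀ ξ, key ξ ∈ ((Finset.univ : Finset (Fin 3 × Fin 3)) ×ˢ
        ((Finset.range (E.card * E.card + 1)) ×ˢ (Finset.univ : Finset Bool)))) ∧
      ∀ ξ ξ', key ξ = key ξ' → ∀ e ∈ E, ∀ e' ∈ E, (wt ξ e ≤ wt ξ e' ↔ wt ξ' e ≤ wt ξ' e') := by
  classical
  set n := E.card with hn
  let σ : ↥E ≃ Fin n := E.equivFin
  let uu : Fin n → ℝ := fun i => (((σ.symm i : ↥E) : Expo) 0 : ℕ)
  let vv : Fin n → ℝ := fun i => (((σ.symm i : ↥E) : Expo) 1 : ℕ)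
  obtain ⟨code, hcode_mem, hcode⟩ := pencilOrder_classes uu vv
  let sgn : ℝ → Fin 3 := fun x => if 0 < x then 0 else if x < 0 then 1 else 2
  have hsgn_pos : ∀ x, sgn x = 0 ↔ 0 < x := fun x => by
    simp only [sgn]; split_ifs with h1 h2 <;> simp [h1]
  have hsgn_neg : ∀ x, sgn x = 1 ↔ x < 0 := fun x => by
    simp only [sgn]; split_ifs with h1 h2
    · simp; linarith
    · simp [h2]
    · simp [h2]
  refine ⟨fun ξ => ((sgn (ξ 0), sgn (ξ 1)), code (ξ 1 / ξ 0)), fun ξ => ?_, fun ξ ξ' hkey e he e' he' => ?_⟩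
  · exact Finset.mem_product.2 ⟨Finset.mem_univ _, hcode_mem _⟩
  have hs0 : sgn (ξ 0) = sgn (ξ' 0) := congrArg (fun k => k.1.1) hkey
  have hs1 : sgn (ξ 1) = sgn (ξ' 1) := congrArg (fun k => k.1.2) hkey
  have hc : code (ξ 1 / ξ 0) = code (ξ' 1 / ξ' 0) := congrArg (fun k => k.2) hkey
  -- the pencil data at `e`, `e'`
  have huu : ∀ (f : Expo) (hf : f ∈ E), uu (σ ⟨f, hf⟩) = ((f 0 : ℕ) : ℝ) := fun f hf => by
    simp [uu, Equiv.symm_apply_apply]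
  have hvv : ∀ (f : Expo) (hf : f ∈ E), vv (σ ⟨f, hf⟩) = ((f 1 : ℕ) : ℝ) := fun f hf => by
    simp [vv, Equiv.symm_apply_apply]
  have hpencil := hcode _ _ hc (σ ⟨e, he⟩) (σ ⟨e', he'⟩)
  rw [huu e he, hvv e he, huu e' he', hvv e' he'] at hpencil
  have hpencil' := hcode _ _ hc (σ ⟨e', he'⟩) (σ ⟨e, he⟩)
  rw [huu e he, hvv e he, huu e' he', hvv e' he'] at hpencil'
  simp only [wt]
  -- sign cases on `ξ 0`
  rcases lt_trichotomy 0 (ξ 0) with h0 | h0 | h0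
  · have h0' : 0 < ξ' 0 := (hsgn_pos _).1 (hs0 ▸ (hsgn_pos _).2 h0)
    -- divide by `ξ 0 > 0`
    have key1 : ∀ (ζ : Fin 2 → ℝ), 0 < ζ 0 → ∀ (a0 a1 b0 b1 : ℝ),
        (ζ 0 * a0 + ζ 1 * a1 ≤ ζ 0 * b0 + ζ 1 * b1 ↔ a0 + ζ 1 / ζ 0 * a1 ≤ b0 + ζ 1 / ζ 0 * b1) := by
      intro ζ hζ a0 a1 b0 b1
      have hne : ζ 0 ≠ 0 := ne_of_gt hζ
      have e1 : ζ 0 * (a0 + ζ 1 / ζ 0 * a1) = ζ 0 * a0 + ζ 1 * a1 := by field_simp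
      have e2 : ζ 0 * (b0 + ζ 1 / ζ 0 * b1) = ζ 0 * b0 + ζ 1 * b1 := by field_simp
      rw [← e1, ← e2]
      exact mul_le_mul_iff_right₀ hζ
    rw [key1 ξ h0, key1 ξ' h0']
    exact hpencil
  · -- `ξ 0 = 0`
    have h0' : ξ' 0 = 0 := by
      rcases lt_trichotomy 0 (ξ' 0) with h | h | h
      · exact absurd (hs0.symm ▸ (hsgn_pos _).2 h : sgn (ξ 0) = 0) (by rw [hsgn_pos]; linarith)
      · exact h.symm
      · exact absurd (hs0.symm ▸ (hsgn_neg _).2 h : sgn (ξ 0) = 1) (by rw [hsgn_neg]; linarith)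
    rw [← h0, h0']
    simp only [zero_mul, zero_add]
    rcases lt_trichotomy 0 (ξ 1) with h1 | h1 | h1
    · have h1' : 0 < ξ' 1 := (hsgn_pos _).1 (hs1 ▸ (hsgn_pos _).2 h1)
      rw [mul_le_mul_iff_right₀ h1, mul_le_mul_iff_right₀ h1']
    · have h1' : ξ' 1 = 0 := by
        rcases lt_trichotomy 0 (ξ' 1) with h | h | h
        · exact absurd (hs1.symm ▸ (hsgn_pos _).2 h : sgn (ξ 1) = 0) (by rw [hsgn_pos]; linarith)
        · exact h.symm
        · exact absurd (hs1.symm ▸ (hsgn_neg _).2 h : sgn (ξ 1) = 1) (by rw [hsgn_neg]; linarith)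
      rw [← h1, h1']
    · have h1' : ξ' 1 < 0 := (hsgn_neg _).1 (hs1 ▸ (hsgn_neg _).2 h1)
      rw [mul_le_mul_left_of_neg h1, mul_le_mul_left_of_neg h1']
  · have h0' : ξ' 0 < 0 := (hsgn_neg _).1 (hs0 ▸ (hsgn_neg _).2 h0)
    have key2 : ∀ (ζ : Fin 2 → ℝ), ζ 0 < 0 → ∀ (a0 a1 b0 b1 : ℝ),
        (ζ 0 * a0 + ζ 1 * a1 ≤ ζ 0 * b0 + ζ 1 * b1 ↔ b0 + ζ 1 / ζ 0 * b1 ≤ a0 + ζ 1 / ζ 0 * a1) := by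
      intro ζ hζ a0 a1 b0 b1
      have hne : ζ 0 ≠ 0 := ne_of_lt hζ
      have e1 : ζ 0 * (a0 + ζ 1 / ζ 0 * a1) = ζ 0 * a0 + ζ 1 * a1 := by field_simp
      have e2 : ζ 0 * (b0 + ζ 1 / ζ 0 * b1) = ζ 0 * b0 + ζ 1 * b1 := by field_simp
      rw [← e1, ← e2]
      exact mul_le_mul_left_of_neg hζ
    rw [key2 ξ h0, key2 ξ' h0']
    exact hpencil'

variable {m : ℕ}

/-- Arithmetic of the transfer: `9·2(E² + 1) · 2^{am}(t+2)^b ≤ 2^{(a+7)m}(t+2)^{b+3}` when `E ≤ 2mt`, `t ≥ 2`.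
[folklore] -/
theorem planarCell_arith (a b m t E : ℕ) (ht : 2 ≤ t) (hE : E ≤ 2 * m * t) :
    9 * (2 * (E * E + 1)) * (2 ^ (a * m) * (t + 2) ^ b) ≤ 2 ^ ((a + 7) * m) * (t + 2) ^ (b + 3) := by
  rcases Nat.eq_zero_or_pos m with hm0 | hmpos
  · subst hm0
    have hE0 : E = 0 := by omega
    subst hE0
    have h64 : 18 ≤ (t + 2) ^ 3 := le_trans (by norm_num) (Nat.pow_le_pow_left (by omega : 4 ≤ t + 2) 3)
    calc 9 * (2 * (0 * 0 + 1)) * (2 ^ (a * 0) * (t + 2) ^ b) = 18 * (t + 2) ^ b := by ring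
      _ ≤ (t + 2) ^ 3 * (t + 2) ^ b := Nat.mul_le_mul_right _ h64
      _ = 2 ^ ((a + 7) * 0) * (t + 2) ^ (b + 3) := by ring
  have hE2 : E * E ≤ 4 * m * m * (t * t) := by nlinarith
  -- `72 m² + 18 ≤ 2^(7m)` for `m ≥ 1`
  have hm : 72 * (m * m) + 18 ≤ 2 ^ (7 * m) := by
    rcases Nat.lt_or_ge m 2 with h | h
    · have : m = 1 := by omega
      subst this; norm_num
    · have h2 : m < 2 ^ m := Nat.lt_two_pow_self
      have hsq : m * m ≤ 4 ^ m := by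
        have : 4 ^ m = 2 ^ m * 2 ^ m := by rw [← mul_pow]; norm_num
        rw [this]; exact Nat.mul_le_mul h2.le h2.le
      have h32 : 90 ≤ 32 ^ m := le_trans (by norm_num) (Nat.pow_le_pow_right (by norm_num) h)
      have h128 : 2 ^ (7 * m) = 32 ^ m * 4 ^ m := by
        rw [pow_mul, ← mul_pow]; norm_num
      rw [h128]
      calc 72 * (m * m) + 18 ≤ 90 * (m * m) := by nlinarith
        _ ≤ 32 ^ m * 4 ^ m := Nat.mul_le_mul h32 hsq
  calc 9 * (2 * (E * E + 1)) * (2 ^ (a * m) * (t + 2) ^ b)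
      ≤ 9 * (2 * (4 * m * m * (t * t) + 1)) * (2 ^ (a * m) * (t + 2) ^ b) := by gcongr
    _ ≤ ((72 * (m * m) + 18) * (t + 2) ^ 2) * (2 ^ (a * m) * (t + 2) ^ b) := by
        refine Nat.mul_le_mul_right _ ?_
        nlinarith
    _ ≤ (2 ^ (7 * m) * (t + 2) ^ 2) * (2 ^ (a * m) * (t + 2) ^ b) := by gcongr
    _ = 2 ^ ((a + 7) * m) * (t + 2) ^ (b + 2) := by ring
    _ ≤ 2 ^ ((a + 7) * m) * (t + 2) ^ (b + 3) :=
        Nat.mul_le_mul_left _ (Nat.pow_le_pow_right (by omega) (by omega))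

/-- **`PlanarCellBound ⇒ LogSumEngine`** (sweep transfer).  If log-visible points of a cell family (common weight
order on the tail support `⋃ supp u_j ∪ ⋃ supp v_j`) number at most `2^{am}(t+2)^b`, then all log-visible points
number at most `2^{(a+7)m}(t+2)^{b+3}`: split any finite set of them by the order class of a witness weight
(`planarOrder_classes`, `≤ 18((2mt)² + 1)` classes). [folklore] -/
theorem logSumEngine_of_planarCellBound
    (hP : ∃ a b : ℕ, ∀ (m t : ℕ), 2 ≤ t → ∀ (u v : Fin m → MvPolynomial (Fin 2) ℂ),
      (∀ j, coeff 0 (u j) = 0 ∧ (u j).support.card ≤ t) → (∀ j, coeff 0 (v j) = 0 ∧ (v j).support.card ≤ t) →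
      ∀ (R : Expo → Expo → Prop) (S : Finset Expo),
        (∀ l ∈ S, ∃ ξ : Fin 2 → ℝ, ValidWeight u v ξ ∧ IsStrictTop ξ (logSupport u v) l ∧
          ∀ e ∈ ((Finset.univ.biUnion fun j => (u j).support) ∪ Finset.univ.biUnion fun j => (v j).support),
          ∀ e' ∈ ((Finset.univ.biUnion fun j => (u j).support) ∪ Finset.univ.biUnion fun j => (v j).support),
            (R e e' ↔ wt ξ e ≤ wt ξ e')) →
        S.card ≤ 2 ^ (a * m) * (t + 2) ^ b) :
    ∃ a b : ℕ, ∀ (m t : ℕ), 2 ≤ t → ∀ (u v : Fin m → MvPolynomial (Fin 2) ℂ),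
      (∀ j, coeff 0 (u j) = 0 ∧ (u j).support.card ≤ t) → (∀ j, coeff 0 (v j) = 0 ∧ (v j).support.card ≤ t) →
        ∀ S : Finset Expo, (↑S ⊆ logVisible u v) → S.card ≤ 2 ^ (a * m) * (t + 2) ^ b := by
  classical
  obtain ⟨a, b, hP⟩ := hP
  refine ⟨a + 7, b + 3, fun m t ht u v hu hv S hS => ?_⟩
  set E : Finset Expo := (Finset.univ.biUnion fun j => (u j).support) ∪
    Finset.univ.biUnion fun j => (v j).support with hE
  -- the tail support has at most `2mt` points
  have hEcard : E.card ≤ 2 * m * t := by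
    calc E.card ≤ (Finset.univ.biUnion fun j => (u j).support).card +
          (Finset.univ.biUnion fun j => (v j).support).card := Finset.card_union_le _ _
      _ ≤ (∑ j : Fin m, ((u j).support).card) + ∑ j : Fin m, ((v j).support).card :=
          Nat.add_le_add Finset.card_biUnion_le Finset.card_biUnion_le
      _ ≤ (∑ _j : Fin m, t) + ∑ _j : Fin m, t :=
          Nat.add_le_add (Finset.sum_le_sum fun j _ => (hu j).2) (Finset.sum_le_sum fun j _ => (hv j).2)
      _ = 2 * m * t := by simp; ring
  obtain ⟨key, hkey_mem, hkey⟩ := planarOrder_classes E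
  -- witness weights
  have hS' : ∀ l ∈ S, ∃ ξ : Fin 2 → ℝ, ValidWeight u v ξ ∧ IsStrictTop ξ (logSupport u v) l :=
    fun l hl => hS hl
  choose! ξ hξvalid hξtop using hS'
  -- each key class is a cell family
  have hfib : ∀ k ∈ S.image (fun l => key (ξ l)), (S.filter fun l => key (ξ l) = k).card ≤
      2 ^ (a * m) * (t + 2) ^ b := by
    intro k hk
    obtain ⟨l₀, hl₀, rfl⟩ := Finset.mem_image.1 hk
    refine hP m t ht u v hu hv (fun e e' => wt (ξ l₀) e ≤ wt (ξ l₀) e') _ fun l hl => ?_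
    obtain ⟨hlS, hlk⟩ := Finset.mem_filter.1 hl
    exact ⟨ξ l, hξvalid l hlS, hξtop l hlS, fun e he e' he' => hkey _ _ hlk.symm e he e' he'⟩
  have himg : (S.image fun l => key (ξ l)).card ≤ 9 * (2 * (E.card * E.card + 1)) := by
    calc (S.image fun l => key (ξ l)).card
        ≤ (((Finset.univ : Finset (Fin 3 × Fin 3)) ×ˢ
            ((Finset.range (E.card * E.card + 1)) ×ˢ (Finset.univ : Finset Bool)))).card :=
          Finset.card_le_card fun k hk => by
            obtain ⟨l, _, rfl⟩ := Finset.mem_image.1 hk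
            exact hkey_mem _
      _ = 9 * (2 * (E.card * E.card + 1)) := by
          simp [Finset.card_product, Finset.card_univ, mul_comm]
  calc S.card ≤ 2 ^ (a * m) * (t + 2) ^ b * (S.image fun l => key (ξ l)).card :=
        Finset.card_le_mul_card_image S _ hfib
    _ ≤ 2 ^ (a * m) * (t + 2) ^ b * (9 * (2 * (E.card * E.card + 1))) := Nat.mul_le_mul_left _ himg
    _ = 9 * (2 * (E.card * E.card + 1)) * (2 ^ (a * m) * (t + 2) ^ b) := by ring
    _ ≤ 2 ^ ((a + 7) * m) * (t + 2) ^ (b + 3) := planarCell_arith a b m t E.card ht hEcard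

/-- **`PlanarCellBound ⇒ TwoProducts`**: the crux reduced to the engine on one weight-order cell of the tail support
(`logSumEngine_of_planarCellBound` composed with `twoProducts_of_logSumEngine`, p585696).  `PlanarCellBound` is OPEN
and NOT claimed. [folklore] -/
theorem twoProducts_of_planarCellBound
    (hP : ∃ a b : ℕ, ∀ (m t : ℕ), 2 ≤ t → ∀ (u v : Fin m → MvPolynomial (Fin 2) ℂ),
      (∀ j, coeff 0 (u j) = 0 ∧ (u j).support.card ≤ t) → (∀ j, coeff 0 (v j) = 0 ∧ (v j).support.card ≤ t) →
      ∀ (R : Expo → Expo → Prop) (S : Finset Expo),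
        (∀ l ∈ S, ∃ ξ : Fin 2 → ℝ, ValidWeight u v ξ ∧ IsStrictTop ξ (logSupport u v) l ∧
          ∀ e ∈ ((Finset.univ.biUnion fun j => (u j).support) ∪ Finset.univ.biUnion fun j => (v j).support),
          ∀ e' ∈ ((Finset.univ.biUnion fun j => (u j).support) ∪ Finset.univ.biUnion fun j => (v j).support),
            (R e e' ↔ wt ξ e ≤ wt ξ e')) →
        S.card ≤ 2 ^ (a * m) * (t + 2) ^ b) :
    Summit.ValiantsHypothesis.ValiantsHypothesis.Theses.NewtonUnitEquations.TwoProducts :=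
  twoProducts_of_logSumEngine (logSumEngine_of_planarCellBound hP)

end Summit.ValiantsHypothesis.ValiantsHypothesis.Theorems.NewtonUnitEquations.TwoProducts.FormalLogLinearisation

end
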